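import Summits.Schanuel.Schanuel.Theses.MatrixCoefficients
import Literature.Barriers.Schanuel.AlgebraicIndependenceOfLogarithmsRankProofs
import Literature.NumberTheory.Transcendental.BakerCoefficientForm
import Summits.Schanuel.Schanuel.Statement
import HarnessLib

/-!
# RootDecomp1 — the ELLIPTIC NORMAL FORM of piece D's cubic stratum (the vertex ladder) · part 01 of 2
(part 01 = §1–§4: algebraic-coefficient transfer, Baker independence of affine log-forms, the cone transfer,
the binary-form floor rung; part 02 = §5–§7: rational-frame descent, the converse/equivalence, on-path —
imports this file)
(cell decomp-schanuel · lens-1 «grading / quantitative ladder» · g23 · route `route-Schanuel-RootDecomp1`,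
piece D = `DisjointSaturatedEssentialSchanuel`, stmt-Schanuel-30353; registered inputs used only as
HYPOTHESES: `Literature.Barriers.Schanuel.AlgIndepLogarithms` (= `Theses.MatrixCoefficients.LogSector`,
stmt-Schanuel-4310) and the summit `_root_.Schanuel`; unconditional inputs: the tree's Baker theorem in
coefficient form `baker_coeff_eq_zero` and the `L̃`/`𝓛` spaces `logLinearForms`/`logQSpan`)

Piece D's genuine residue in degree `n` (after the affine, quadratic and rational-image scopes h4–h6 and
`RationalImageSchanuel`, stmt-29644) begins, in the pure-logarithm sector `z ∈ 𝓛ⁿ`, with the CUBIC stratum: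
a `ℚ`-linearly independent `n`-tuple of logarithms of algebraic numbers on a cubic hypersurface with algebraic
coefficients that is not unirational.  Lens-1 g21/g22 (`RootDecomp1IsotropySieve`, `RootDecomp1MCLadder01/02`)
graded the `ℚ`-DETERMINANTAL part of this residue by the pencil size and decided it modulo the Matrix
Coefficient Conjecture.  This file grades the WHOLE cubic stratum by a different, geometric index — the
VERTEX of the cone — and shows that the grading COLLAPSES onto one `n`-free statement per curve:

* NORMAL FORM.  For `n ≥ 3` a non-unirational cubic cone cell is `F = E ∘ ℓ`, where `E` is a plane cubic with
  algebraic coefficients (smooth in the residue: singular plane cubics are rational, hence in stmt-29644's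
  scope) and `ℓ = (ℓ₁, ℓ₂, ℓ₃)` are three affine forms `ℓⱼ = cⱼ + ∑ₖ aⱼₖXₖ` with ALGEBRAIC coefficients,
  `ℚ̄`-linearly independent as vectors `(cⱼ, aⱼ) ∈ ℚ̄ⁿ⁺¹` — cones through `0` (`c = 0`), cones with a finite
  algebraic vertex (`c ≠ 0`, linear parts of rank 3), cylinders in an irrational algebraic direction (linear
  parts of rank 2), and for `n ≥ 4` all of these with positive-dimensional `ℚ̄`-vertex.  For every such cell
  and every `n` (§3, `eval_cone_ne_zero_of_logFree`, `schanuel_ineq_on_cone_of_logFree`):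
  `ELF(E) ⟹ no ℚ-linearly independent λ ∈ 𝓛ⁿ lies on the cell ⟹ D holds on the cell (vacuously)`, where
  `ELF(E)` («`E` is log-free») is the `n`-FREE statement
  `∀ m ∈ L̃³, m ℚ̄-linearly independent ⟹ E(m) ≠ 0`, `L̃ = logLinearForms` = Waldschmidt's `ℚ̄`-span of `1`
  and the logarithms of algebraic numbers.  The transfer is Baker's theorem: the values `ℓⱼ(1, λ)` of
  `ℚ̄`-independent affine forms at `ℚ`-independent logarithms are `ℚ̄`-linearly independent elements of `L̃`
  (§2, `linearIndependent_affineLog`, from the tree's `baker_coeff_eq_zero`).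
* EQUIVALENCE (§6, `logFree_iff_coneCells`, via `exists_affineLog_eq`).  Conversely every `ℚ̄`-linearly
  independent `m ∈ L̃ʳ` IS such an affine-log tuple (choose a `ℚ`-basis `λ` of the logarithms occurring in
  `m`), so for ANY polynomial `E` in `r` variables: `ELF(E) ⟺ (∀ n, no cone cell over E at level n carries a
  ℚ-linearly independent point of 𝓛ⁿ)`.  The vertex grading of the cubic stratum of D, over all degrees `n`
  and all vertex types, is therefore EQUIVALENT to the family `{ELF(E) : E smooth plane cubic over ℚ̄}` —
  one statement per elliptic curve, none of them mentioning `n`.  (Honest label: a REFORMULATION of the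
  stratum, not a decision; `ELF(E)` is a degree-3 fragment of the conjecture on algebraic independence of
  logarithms and is OPEN for every single smooth `E`.)
* FLOOR RUNG (§4, `binaryForm_affineLog_ne_zero`, unconditional).  Form-rank ≤ 2 — `F = e(ℓ′, ℓ″)` with `e`
  a binary form — is a THEOREM for all `n` (Baker: a binary form splits over `ℚ̄` into linear factors); these
  cells are unions of `ℚ̄`-hyperplanes, hence ALSO inside D's affine scope h4: the floor, not residue.
* DESCENT (§5, `not_spanMinimal_of_ratFrame`, `schanuel_ineq_of_ratFrame_relation`, unconditional).  A
  relation among `λ` that factors through a RATIONAL frame `w = Mλ`, `M ∈ M_{r×n}(ℚ)`, `r < n`, forces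
  `trdeg ℚ(w, e^w) < r` and so contradicts D's span-minimality binder at `m = r`: D is VACUOUS on every cell
  of rational hull rank `< n`.  Consequently, at `n = 3` the cylinders over plane cubics in a RATIONAL
  direction are not D₃'s — they are `SchanuelTwo`'s (stmt-0069) logarithmic sector; only IRRATIONAL
  algebraic directions stay in D₃, and those are cells of the normal form above.
* ON-PATH (§1 `eval_log_ne_zero_of_schanuel`, §7 `eval_linLog_ne_zero_of_schanuel`).  The summit (indeed
  `AlgIndepLogarithms`) implies every instance: `ℚ`-independent logarithms are `ℚ̄`-algebraically
  independent, and so are the values of independent LINEAR forms in them (§7, a left-inverse substitution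
  argument), which gives `ELF(E)` cell by cell (`e(u) = E(c + u)` for finite vertices, `e(u, v) = E(1, u, v)`
  for cylinders).

Nearest prior art.  Unconditionally, print reaches homogeneous QUADRATIC relations, and only under
`trdeg ℚ(λ) = 1` (Roy–Waldschmidt; [cite: Waldschmidt2000GL326, Theorem 15.30]); cubic relations among
logarithms appear in print only as determinantal consequences of Roy's rank conjecture
([cite: Waldschmidt2005, §1 Consequences 1.12–1.13]).  Barrier placement: `ELF(E)` lies INSIDE
`Literature.Barriers.Schanuel.AlgebraicIndependenceOfLogarithms` (it is a fragment of it) and inside the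
structural-rank barrier (`rank > ½·r_str` decides `2 × 2`, not `3 × 3`, presentations); the floor rung and the
descent are linear (Baker) and lie outside.  `Schanuel`, `AlgIndepLogarithms`, `LogSector` occur only as
hypotheses; no `Prop` definitions, no instances, no notation, no axioms beyond the standard three.
-/

noncomputable section

open Complex
open scoped BigOperators

namespace Summit.Schanuel.Schanuel.Theorems.RootDecomp1EllipticNormalForm

open Literature.Barriers.Schanuel (logLinearForms logQSpan AlgIndepLogarithms
  algIndepLogarithms_of_schanuel trdeg_adjoin_union_eq_of_isAlgebraic
  algebraicIndependent_of_le_trdeg_adjoin isAlgebraic_cexp_of_mem_logQSpan)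
open Literature.NumberTheory.Transcendental (baker_coeff_eq_zero)

/-! ## §1 Polynomials with algebraic coefficients and `ℚ̄`-algebraic independence -/

/-- A complex polynomial all of whose coefficients are algebraic over `ℚ` is the image of a polynomial
with coefficients in the field `ℚ̄ = algebraicClosure ℚ ℂ` of algebraic numbers. [folklore] -/
theorem exists_map_eq_of_coeff_isAlgebraic {σ : Type*} (G : MvPolynomial σ ℂ)
    (hG : ∀ m, IsAlgebraic ℚ (MvPolynomial.coeff m G)) :
    ∃ G₀ : MvPolynomial σ (algebraicClosure ℚ ℂ),
      MvPolynomial.map (algebraMap (algebraicClosure ℚ ℂ) ℂ) G₀ = G := by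
  have h : G ∈ Set.range (MvPolynomial.map (algebraMap (algebraicClosure ℚ ℂ) ℂ)) := by
    refine MvPolynomial.mem_range_map_iff_coeffs_subset.2 fun c hc => ?_
    obtain ⟨m, -, rfl⟩ := MvPolynomial.mem_coeffs_iff.1 hc
    exact ⟨⟨_, mem_algebraicClosure_iff.2 (hG m)⟩, rfl⟩
  exact h

/-- If `x` is algebraically independent over `ℚ`, then NO non-zero complex polynomial with ALGEBRAIC
coefficients vanishes at `x`: algebraic independence persists over the algebraic extension `ℚ̄/ℚ`
(Mathlib's `AlgebraicIndependent.extendScalars`). [folklore] -/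
theorem eval_ne_zero_of_algebraicIndependent {σ : Type*} {x : σ → ℂ} (hx : AlgebraicIndependent ℚ x)
    (G : MvPolynomial σ ℂ) (hG : ∀ m, IsAlgebraic ℚ (MvPolynomial.coeff m G)) (hG0 : G ≠ 0) :
    MvPolynomial.eval x G ≠ 0 := by
  obtain ⟨G₀, rfl⟩ := exists_map_eq_of_coeff_isAlgebraic G hG
  haveI : Algebra.IsAlgebraic ℚ (algebraicClosure ℚ ℂ) := algebraicClosure.isAlgebraic ℚ ℂ
  have hind : AlgebraicIndependent (algebraicClosure ℚ ℂ) x := hx.extendScalars _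
  intro h0
  rw [MvPolynomial.eval_map, ← MvPolynomial.aeval_def] at h0
  have hz := hind.eq_zero_of_aeval_eq_zero _ h0
  exact hG0 (by rw [hz, map_zero])

/-- **On-path bookkeeping (log sector).**  Under the algebraic independence of logarithms
(`Literature.Barriers.Schanuel.AlgIndepLogarithms`, registered verbatim as item stmt-Schanuel-4310
`LogSector`; implied by the summit, `algIndepLogarithms_of_schanuel`), a `ℚ`-linearly independent tuple
of logarithms of algebraic numbers lies on NO hypersurface `G = 0`, `G ≠ 0` with algebraic coefficients —
in particular on no cubic cone, cylinder or translated cone of the vertex ladder below, for every `n`.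
[cite: Waldschmidt2005, §1 Conjecture 1.1] -/
theorem eval_log_ne_zero_of_algIndepLogarithms (hAIL : AlgIndepLogarithms) {n : ℕ} (l : Fin n → ℂ)
    (halg : ∀ k, IsAlgebraic ℚ (cexp (l k))) (hli : LinearIndependent ℚ l)
    (G : MvPolynomial (Fin n) ℂ) (hG : ∀ m, IsAlgebraic ℚ (MvPolynomial.coeff m G)) (hG0 : G ≠ 0) :
    MvPolynomial.eval l G ≠ 0 :=
  eval_ne_zero_of_algebraicIndependent (hAIL n l halg hli) G hG hG0

/-- The same from the registered item `LogSector` (stmt-Schanuel-4310) of route MatrixCoefficients, whose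
signature is `AlgIndepLogarithms` verbatim. [cite: Waldschmidt2005, §1 Conjecture 1.1] -/
theorem eval_log_ne_zero_of_logSector (h : Summit.Schanuel.Schanuel.Theses.MatrixCoefficients.LogSector)
    {n : ℕ} (l : Fin n → ℂ) (halg : ∀ k, IsAlgebraic ℚ (cexp (l k))) (hli : LinearIndependent ℚ l)
    (G : MvPolynomial (Fin n) ℂ) (hG : ∀ m, IsAlgebraic ℚ (MvPolynomial.coeff m G)) (hG0 : G ≠ 0) :
    MvPolynomial.eval l G ≠ 0 :=
  eval_log_ne_zero_of_algIndepLogarithms (fun n l ha hl => h n l ha hl) l halg hli G hG hG0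

/-- **The summit is on-path for every cell of the ladder**: Schanuel's conjecture implies that a
`ℚ`-linearly independent tuple of logarithms of algebraic numbers lies on no hypersurface with algebraic
coefficients (summit ⟹ `AlgIndepLogarithms`, tree theorem `algIndepLogarithms_of_schanuel`).
[cite: Waldschmidt2005, §1 Conjecture 1.1] -/
theorem eval_log_ne_zero_of_schanuel (hS : _root_.Schanuel) {n : ℕ} (l : Fin n → ℂ)
    (halg : ∀ k, IsAlgebraic ℚ (cexp (l k))) (hli : LinearIndependent ℚ l)
    (G : MvPolynomial (Fin n) ℂ) (hG : ∀ m, IsAlgebraic ℚ (MvPolynomial.coeff m G)) (hG0 : G ≠ 0) :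
    MvPolynomial.eval l G ≠ 0 :=
  eval_log_ne_zero_of_algIndepLogarithms (algIndepLogarithms_of_schanuel fun k y hy => hS k y hy)
    l halg hli G hG hG0

/-! ## §2 Affine forms in logarithms: membership in `L̃` and `ℚ̄`-linear independence (Baker) -/

/-- A finite sum `∑ⱼ gⱼ cⱼ` with `gⱼ ∈ ℚ̄` and algebraic `cⱼ ∈ ℂ` is algebraic. [folklore] -/
theorem isAlgebraic_sum_coe_mul {ι : Type*} [Fintype ι] (g : ι → algebraicClosure ℚ ℂ) (c : ι → ℂ)
    (hc : ∀ j, IsAlgebraic ℚ (c j)) : IsAlgebraic ℚ (∑ j, (g j : ℂ) * c j) := by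
  have h : (∑ j, (g j : ℂ) * c j) =
      ((∑ j, g j * ⟨c j, mem_algebraicClosure_iff.2 (hc j)⟩ : algebraicClosure ℚ ℂ) : ℂ) := by
    push_cast
    rfl
  rw [h]
  exact mem_algebraicClosure_iff.1 (SetLike.coe_mem _)

/-- The value `c + ∑ₖ aₖ λₖ` of an affine form with ALGEBRAIC coefficients at logarithms of algebraic
numbers `λₖ` lies in Waldschmidt's space `L̃ = ℚ̄ + ℚ̄·𝓛` of linear forms in logarithms
(`Literature.Barriers.Schanuel.logLinearForms`). [cite: Waldschmidt2005, §1 Conjecture 1.5] -/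
theorem affineLog_mem_logLinearForms {n : ℕ} (l : Fin n → ℂ) (halg : ∀ k, IsAlgebraic ℚ (cexp (l k)))
    (c : ℂ) (a : Fin n → ℂ) (hc : IsAlgebraic ℚ c) (ha : ∀ k, IsAlgebraic ℚ (a k)) :
    c + ∑ k, a k * l k ∈ logLinearForms := by
  unfold logLinearForms
  refine Submodule.add_mem _ ?_ (Submodule.sum_mem _ fun k _ => ?_)
  · have h1 : c = (⟨c, mem_algebraicClosure_iff.2 hc⟩ : algebraicClosure ℚ ℂ) • (1 : ℂ) := by
      rw [IntermediateField.smul_def, smul_eq_mul, mul_one]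
    rw [h1]
    exact Submodule.smul_mem _ _ (Submodule.subset_span (Set.mem_union_left _ (Set.mem_singleton _)))
  · have h2 : a k * l k = (⟨a k, mem_algebraicClosure_iff.2 (ha k)⟩ : algebraicClosure ℚ ℂ) • l k := by
      rw [IntermediateField.smul_def, smul_eq_mul]
    rw [h2]
    exact Submodule.smul_mem _ _ (Submodule.subset_span (Set.mem_union_right _ (halg k)))

/-- **Baker bookkeeping.**  Let `λ₁, …, λₙ` be `ℚ`-linearly independent logarithms of algebraic numbers
and let `ℓⱼ(X₀, X) = cⱼ X₀ + ∑ₖ aⱼₖ Xₖ` (`j < r`) be affine forms with algebraic coefficients which are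
linearly independent over `ℚ̄` (as coefficient vectors `(cⱼ, aⱼ₁, …, aⱼₙ) ∈ ℂⁿ⁺¹`).  Then the values
`mⱼ = ℓⱼ(1, λ)` are `ℚ̄`-linearly independent: a relation `∑ gⱼ mⱼ = 0` is a relation
`β₀ + ∑ₖ βₖ λₖ = 0` with algebraic `β₀ = ∑ gⱼcⱼ`, `βₖ = ∑ gⱼaⱼₖ`, all of which vanish by Baker's theorem
(tree: `baker_coeff_eq_zero`), i.e. `∑ gⱼ ℓⱼ = 0`. [cite: Baker1975, Theorem 2.1] -/
theorem linearIndependent_affineLog {n r : ℕ} (l : Fin n → ℂ)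
    (halg : ∀ k, IsAlgebraic ℚ (cexp (l k))) (hli : LinearIndependent ℚ l)
    (c : Fin r → ℂ) (a : Fin r → Fin n → ℂ)
    (hc : ∀ j, IsAlgebraic ℚ (c j)) (ha : ∀ j k, IsAlgebraic ℚ (a j k))
    (hrank : LinearIndependent (algebraicClosure ℚ ℂ)
      (fun j => (Fin.cons (c j) (a j) : Fin (n + 1) → ℂ))) :
    LinearIndependent (algebraicClosure ℚ ℂ) (fun j => c j + ∑ k, a j k * l k) := by
  rw [Fintype.linearIndependent_iff]
  intro g hg
  -- the relation, expanded: `(∑ⱼ gⱼcⱼ) + ∑ₖ (∑ⱼ gⱼaⱼₖ) λₖ = 0`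
  have hrel : (∑ j, (g j : ℂ) * c j) + ∑ k, (∑ j, (g j : ℂ) * a j k) * l k = 0 := by
    have h0 : ∑ j, (g j : ℂ) * (c j + ∑ k, a j k * l k) = 0 := by
      simpa only [IntermediateField.smul_def, smul_eq_mul] using hg
    rw [← h0]
    simp only [mul_add, Finset.sum_add_distrib, Finset.mul_sum, Finset.sum_mul]
    congr 1
    rw [Finset.sum_comm]
    exact Finset.sum_congr rfl fun j _ => Finset.sum_congr rfl fun k _ => by ring
  have hB := baker_coeff_eq_zero l halg hli (β₀ := ∑ j, (g j : ℂ) * c j)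
    (β := fun k => ∑ j, (g j : ℂ) * a j k) (isAlgebraic_sum_coe_mul g c hc)
    (fun k => isAlgebraic_sum_coe_mul g (fun j => a j k) fun j => ha j k) hrel
  -- hence `∑ⱼ gⱼ • (cⱼ, aⱼ) = 0` in `ℂⁿ⁺¹`, and `g = 0` by the independence of the forms
  have hvec : ∑ j, g j • (Fin.cons (c j) (a j) : Fin (n + 1) → ℂ) = 0 := by
    funext i
    rw [Finset.sum_apply, Pi.zero_apply]
    refine Fin.cases ?_ (fun k => ?_) i
    · simpa only [Pi.smul_apply, Fin.cons_zero, IntermediateField.smul_def, smul_eq_mul] using hB.1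
    · simpa only [Pi.smul_apply, Fin.cons_succ, IntermediateField.smul_def, smul_eq_mul] using hB.2 k
  exact Fintype.linearIndependent_iff.mp hrank g hvec

/-- `ℂ`-linear independence of the coefficient vectors (a non-vanishing `r × r` minor, say) suffices.
[folklore] -/
theorem linearIndependent_algClosure_of_complex {r N : ℕ} {v : Fin r → Fin N → ℂ}
    (hv : LinearIndependent ℂ v) : LinearIndependent (algebraicClosure ℚ ℂ) v :=
  hv.restrict_scalars' (algebraicClosure ℚ ℂ)

/-! ## §3 The transfer: `E(L̃)` free of independent points ⟹ every cone over `E` is log-free, all `n` -/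

/-- **ELLIPTIC NORMAL FORM ⟹ all cone cells, every `n`, every `ℚ̄`-vertex.**  Let `E` be a complex
polynomial in `r` variables (the case of interest: `r = 3`, `E` a smooth ternary cubic form with algebraic
coefficients) such that `E` has NO zero `m ∈ L̃ʳ` with `ℚ̄`-linearly independent coordinates.  Then for
every `n`, every `ℚ`-linearly independent `n`-tuple `λ` of logarithms of algebraic numbers and every
`r`-tuple of `ℚ̄`-linearly independent affine forms `ℓⱼ = cⱼX₀ + ∑ₖ aⱼₖXₖ` with algebraic coefficients,
`E(ℓ₁(1,λ), …, ℓ_r(1,λ)) ≠ 0`: the tuple `λ` does not lie on the hypersurface `E ∘ ℓ = 0` — for `r = 3`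
the cone over the plane curve `E = 0` with vertex `{ℓ = 0} ⊂ ℙⁿ` (cones through the origin, translated
cones with an algebraic vertex, cylinders in any algebraic direction, and their positive-dimensional-vertex
analogues for `n ≥ 4`).  Proof: `mⱼ = ℓⱼ(1,λ) ∈ L̃` (`affineLog_mem_logLinearForms`) and the `mⱼ` are
`ℚ̄`-linearly independent by Baker (`linearIndependent_affineLog`). [cite: Baker1975, Theorem 2.1] -/
theorem eval_affineLog_ne_zero_of_logFree {n r : ℕ} (E : MvPolynomial (Fin r) ℂ)
    (hE : ∀ m : Fin r → ℂ, (∀ j, m j ∈ logLinearForms) →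
      LinearIndependent (algebraicClosure ℚ ℂ) m → MvPolynomial.eval m E ≠ 0)
    (l : Fin n → ℂ) (halg : ∀ k, IsAlgebraic ℚ (cexp (l k))) (hli : LinearIndependent ℚ l)
    (c : Fin r → ℂ) (a : Fin r → Fin n → ℂ)
    (hc : ∀ j, IsAlgebraic ℚ (c j)) (ha : ∀ j k, IsAlgebraic ℚ (a j k))
    (hrank : LinearIndependent (algebraicClosure ℚ ℂ)
      (fun j => (Fin.cons (c j) (a j) : Fin (n + 1) → ℂ))) :
    MvPolynomial.eval (fun j => c j + ∑ k, a j k * l k) E ≠ 0 :=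
  hE _ (fun j => affineLog_mem_logLinearForms l halg (c j) (a j) (hc j) (ha j))
    (linearIndependent_affineLog l halg hli c a hc ha hrank)

/-- The affine substitution `Xⱼ ↦ cⱼ + ∑ₖ aⱼₖ Yₖ` as a tuple of polynomials in `Y`. -/
-- (no `def`: the substitution is written out where it is used)
theorem eval_bind₁_affine {n r : ℕ} (E : MvPolynomial (Fin r) ℂ) (c : Fin r → ℂ)
    (a : Fin r → Fin n → ℂ) (x : Fin n → ℂ) :
    MvPolynomial.eval x (MvPolynomial.bind₁
        (fun j => MvPolynomial.C (c j) + ∑ k, MvPolynomial.C (a j k) * MvPolynomial.X k) E) =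
      MvPolynomial.eval (fun j => c j + ∑ k, a j k * x k) E := by
  have hfun : (fun j => MvPolynomial.aeval x
        (MvPolynomial.C (c j) + ∑ k, MvPolynomial.C (a j k) * MvPolynomial.X k)) =
      fun j => c j + ∑ k, a j k * x k := by
    funext j
    simp [map_sum]
  rw [← MvPolynomial.aeval_eq_eval, MvPolynomial.aeval_bind₁, hfun, MvPolynomial.aeval_eq_eval]

/-- The cone cell in the format «`λ` lies on the hypersurface `F = 0` of `ℂⁿ`», `F = E ∘ ℓ` the pulled-back
polynomial: under the normal-form hypothesis on `E`, `F(λ) ≠ 0`. [cite: Baker1975, Theorem 2.1] -/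
theorem eval_cone_ne_zero_of_logFree {n r : ℕ} (E : MvPolynomial (Fin r) ℂ)
    (hE : ∀ m : Fin r → ℂ, (∀ j, m j ∈ logLinearForms) →
      LinearIndependent (algebraicClosure ℚ ℂ) m → MvPolynomial.eval m E ≠ 0)
    (l : Fin n → ℂ) (halg : ∀ k, IsAlgebraic ℚ (cexp (l k))) (hli : LinearIndependent ℚ l)
    (c : Fin r → ℂ) (a : Fin r → Fin n → ℂ)
    (hc : ∀ j, IsAlgebraic ℚ (c j)) (ha : ∀ j k, IsAlgebraic ℚ (a j k))
    (hrank : LinearIndependent (algebraicClosure ℚ ℂ)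
      (fun j => (Fin.cons (c j) (a j) : Fin (n + 1) → ℂ))) :
    MvPolynomial.eval l (MvPolynomial.bind₁
        (fun j => MvPolynomial.C (c j) + ∑ k, MvPolynomial.C (a j k) * MvPolynomial.X k) E) ≠ 0 := by
  rw [eval_bind₁_affine]
  exact eval_affineLog_ne_zero_of_logFree E hE l halg hli c a hc ha hrank

/-- **Piece D on the elliptic-cone cells, in D's own format (vacuously).**  Under the normal-form
hypothesis on `E`, Schanuel's inequality holds at every `ℚ`-linearly independent `n`-tuple of logarithms of
algebraic numbers lying on a cone `E ∘ ℓ = 0` over `E` with `ℚ̄`-vertex — there is none.  (Item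
`DisjointSaturatedEssentialSchanuel`, stmt-Schanuel-30353, restricted to its cubic stratum: such tuples are
exactly the pure-logarithm members of D's v4 residue in degree three, see the module docstring.)
[cite: Baker1975, Theorem 2.1] -/
theorem schanuel_ineq_on_cone_of_logFree {n r : ℕ} (E : MvPolynomial (Fin r) ℂ)
    (hE : ∀ m : Fin r → ℂ, (∀ j, m j ∈ logLinearForms) →
      LinearIndependent (algebraicClosure ℚ ℂ) m → MvPolynomial.eval m E ≠ 0)
    (z : Fin n → ℂ) (hz : LinearIndependent ℚ z) (halg : ∀ k, IsAlgebraic ℚ (Complex.exp (z k)))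
    (c : Fin r → ℂ) (a : Fin r → Fin n → ℂ)
    (hc : ∀ j, IsAlgebraic ℚ (c j)) (ha : ∀ j k, IsAlgebraic ℚ (a j k))
    (hrank : LinearIndependent (algebraicClosure ℚ ℂ)
      (fun j => (Fin.cons (c j) (a j) : Fin (n + 1) → ℂ)))
    (hcone : MvPolynomial.eval (fun j => c j + ∑ k, a j k * z k) E = 0) :
    (n : Cardinal) ≤ Algebra.trdeg ℚ
      ↥(IntermediateField.adjoin ℚ (Set.range z ∪ Set.range (Complex.exp ∘ z))) :=
  absurd hcone (eval_affineLog_ne_zero_of_logFree E hE z halg hz c a hc ha hrank)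

/-! ## §4 The floor rung: form-rank ≤ 2 (binary forms) is unconditional -/

/-- **Binary forms.**  A non-zero binary form with algebraic coefficients — written through its
dehomogenisation `p ≠ 0` as `∑ᵢ pᵢ uⁱ v^{N−i}`, `N ≥ deg p` — does not vanish at a `ℚ̄`-linearly
independent pair `(u, v)`: `v ≠ 0`, `u/v` is a root of `p`, hence algebraic (the polynomial lifts to
`ℚ̄[X]` and `ℚ̄/ℚ` is algebraic — the step is the tree's `isAlgebraic_of_root_of_coeff_isAlgebraic` of file
`ZilberEacPlaceAlgebraic`, re-derived inline to keep this file's imports inside the RootDecomp1 cone), and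
`u − (u/v)·v = 0` would be a non-trivial `ℚ̄`-linear relation. [folklore] -/
theorem binaryForm_ne_zero (p : Polynomial ℂ) (hp0 : p ≠ 0) (hp : ∀ i, IsAlgebraic ℚ (p.coeff i))
    {N : ℕ} (hN : p.natDegree ≤ N) {u v : ℂ}
    (huv : LinearIndependent (algebraicClosure ℚ ℂ) ![u, v]) :
    ∑ i ∈ Finset.range (N + 1), p.coeff i * u ^ i * v ^ (N - i) ≠ 0 := by
  have hv : v ≠ 0 := by
    have h1 := huv.ne_zero 1
    simpa using h1
  intro h
  -- `∑ pᵢ uⁱ v^{N−i} = v^N · p(u/v)`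
  have hsum : ∑ i ∈ Finset.range (N + 1), p.coeff i * u ^ i * v ^ (N - i) =
      v ^ N * p.eval (u / v) := by
    rw [Polynomial.eval_eq_sum_range' (Nat.lt_succ_of_le hN), Finset.mul_sum]
    refine Finset.sum_congr rfl fun i hi => ?_
    have hi' : i ≤ N := Nat.lt_succ_iff.mp (Finset.mem_range.mp hi)
    rw [div_pow, ← pow_sub_mul_pow v hi']
    field_simp
  have hroot : p.eval (u / v) = 0 := by
    have h' : v ^ N * p.eval (u / v) = 0 := by rw [← hsum]; exact h
    exact (mul_eq_zero.mp h').resolve_left (pow_ne_zero _ hv)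
  have htalg : IsAlgebraic ℚ (u / v) := by
    obtain ⟨q, hq⟩ : ∃ q : Polynomial (algebraicClosure ℚ ℂ),
        q.map (algebraMap (algebraicClosure ℚ ℂ) ℂ) = p := by
      rw [← Polynomial.mem_lifts, Polynomial.lifts_iff_coeff_lifts]
      intro i
      exact ⟨⟨_, mem_algebraicClosure_iff.2 (hp i)⟩, rfl⟩
    haveI : Algebra.IsAlgebraic ℚ (algebraicClosure ℚ ℂ) := algebraicClosure.isAlgebraic ℚ ℂ
    have hq0 : q ≠ 0 := by
      rintro rfl
      exact hp0 (by rw [← hq, Polynomial.map_zero])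
    have halgK : IsAlgebraic (algebraicClosure ℚ ℂ) (u / v) :=
      ⟨q, hq0, by rw [Polynomial.aeval_def, ← Polynomial.eval_map, hq, hroot]⟩
    exact halgK.restrictScalars ℚ
  -- the relation `1 • u + (−u/v) • v = 0` over `ℚ̄`
  have hrel : (1 : algebraicClosure ℚ ℂ) • u +
      (-(⟨u / v, mem_algebraicClosure_iff.2 htalg⟩ : algebraicClosure ℚ ℂ)) • v = 0 := by
    rw [one_smul, neg_smul, IntermediateField.smul_def, smul_eq_mul]
    change u + -(u / v * v) = 0
    rw [div_mul_cancel₀ u hv, add_neg_cancel]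
  exact one_ne_zero (LinearIndependent.pair_iff.mp huv _ _ hrel).1

/-- **Floor rung of the vertex ladder (form-rank 2), unconditionally.**  If the form in the `n` logarithms
factors through TWO `ℚ̄`-linearly independent affine forms `ℓ′ = ℓ₀, ℓ″ = ℓ₁` with algebraic
coefficients, `F = e(ℓ′, ℓ″)` with `e ≠ 0` a binary form (here: `eᵢ = pᵢ`, `p ≠ 0`, `N ≥ deg p`), then
`F(λ) ≠ 0` at every `ℚ`-linearly independent tuple `λ` of logarithms of algebraic numbers: the pair
`(ℓ′(1,λ), ℓ″(1,λ))` is `ℚ̄`-linearly independent by Baker (`linearIndependent_affineLog`).  Geometrically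
`{F = 0}` is a union of at most `deg e` hyperplanes defined over `ℚ̄` (a binary form splits over `ℚ̄`), so
inside piece D these cells are ALSO absorbed by the affine scope (binder h4): the rung is the floor of the
ladder, not residue. [cite: Baker1975, Theorem 2.1] -/
theorem binaryForm_affineLog_ne_zero {n : ℕ} (l : Fin n → ℂ)
    (halg : ∀ k, IsAlgebraic ℚ (cexp (l k))) (hli : LinearIndependent ℚ l)
    (p : Polynomial ℂ) (hp0 : p ≠ 0) (hp : ∀ i, IsAlgebraic ℚ (p.coeff i)) {N : ℕ}
    (hN : p.natDegree ≤ N) (c : Fin 2 → ℂ) (a : Fin 2 → Fin n → ℂ)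
    (hc : ∀ j, IsAlgebraic ℚ (c j)) (ha : ∀ j k, IsAlgebraic ℚ (a j k))
    (hrank : LinearIndependent (algebraicClosure ℚ ℂ)
      (fun j => (Fin.cons (c j) (a j) : Fin (n + 1) → ℂ))) :
    ∑ i ∈ Finset.range (N + 1), p.coeff i * (c 0 + ∑ k, a 0 k * l k) ^ i *
      (c 1 + ∑ k, a 1 k * l k) ^ (N - i) ≠ 0 := by
  have hm := linearIndependent_affineLog l halg hli c a hc ha hrank
  refine binaryForm_ne_zero p hp0 hp hN ?_
  convert hm using 1
  funext j
  fin_cases j <;> simp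

end Summit.Schanuel.Schanuel.Theorems.RootDecomp1EllipticNormalForm
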